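import Summits.AnomalousDissipation.AnomalousDissipation.Theorems.MomentParityQuarticGateRows
import Summits.AnomalousDissipation.AnomalousDissipation.Theorems.MomentParityQuarticGateRowPoly
import Summits.AnomalousDissipation.AnomalousDissipation.Theorems.SmoothEulerCoerciveForce.Negative.Translate
import Literature.Analysis.FunctionSpaces.TorusHolderSobolevEmbedding

/-!
# Axial defect certificate for `MomentParity.QuarticGate` (stmt-AnomalousDissipation-11464),
# line `axis-sectors`, stub S3′ — helper I: translation bookkeeping ("AxialCertTranslate")

Support file for the stub `stub_axialDefectCertificate` (the order-3 lever of the line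
`axis-sectors`: cone duality inside the shear-invariant cubic observables, then de-averaging).
Everything the stub needs about TRANSLATIONS `x ↦ x + a` of the torus `T³`, in the vocabulary of
`Theorems/QuarticGate/Negative/LevelCeiling.lean` (`IsLevel`, `IsBandTest`, `polyGrad`) and of an
orthonormal band basis `b` of `V_N` (`exists_bandBasis`; bundle `hb`, `hbo`, `hbs`):

* `isBandTest_comp_add_right` — translates `x ↦ g (x + a)` of band tests are band tests
  (`Torus.IsSmooth.comp_add_right`, `Torus.mFourierCoeff_comp_add_right`, and the pointwise
  translation calculus of `Theorems/SmoothEulerCoerciveForce/Negative/Translate.lean`);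
* `nsGeneratorPairing_translate` — covariance of the generator pairing: for a force with
  `f (x + a) = f x`, `⟨F(u), w(· + a)⟩ = ⟨F(u(· - a)), w⟩` (change of variables on `T³`);
* `synthesis_translate`, `pairing_translate_of_ae_eq` — the translate `u(· - a)` of a level-`N`
  field in coordinates: its coordinate vector is `((u, b_l(· + a)))_l`;
* `nsGeneratorPairing_polyGrad_translate` — the row of the TRANSLATED test family `(b(· + a), P)`
  at `u` is the row of `(b, P)` at `u(· - a)`;
* `polyGrad_bind₁_translate`, `eval_bind₁_translate`, `eval_translate_bind₁_translate` — the
  translated family is the family `b` with the substituted polynomial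
  `P ∘ ρ(a) = bind₁ (j ↦ Σ_l C ∫⟪b_j(· + a), b_l⟫ X_l) P` (`polyGrad_transport`);
* `integral_eval_translate_eq` — a law whose cylindrical statistics are invariant under `a`
  integrates every coordinate polynomial of the translated family to the same value
  (`integral_map`).
-/

-- `Summit.<Summit>.<Problem>` is the tree's mandated summit-side namespace (CONVENTIONS §2); for this
-- single-conjunct summit the two coincide, so the duplicate is deliberate.
set_option linter.dupNamespace false

namespace Summit.AnomalousDissipation.AnomalousDissipation.Theorems.MomentParityQuarticGate

open MeasureTheory Filter MvPolynomial
open scoped InnerProductSpace RealInnerProductSpace ENNReal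
open Literature.Analysis.FunctionSpaces Literature.Analysis.FluidPDE
open Summit.AnomalousDissipation.AnomalousDissipation.Theses.MomentParity
open Summit.AnomalousDissipation.AnomalousDissipation.Theorems.QuarticGate.Negative

namespace AxialCert

variable {N n : ℕ} {b : Fin n → UnitAddTorus (Fin 3) → EuclideanSpace ℝ (Fin 3)}

/-! ## Translates of fields and of band tests -/

/-- The Laplacian of a translate is the translated Laplacian (derivatives on `T³` are taken in the
re-centred lift, `Torus.liftAt (w(· + a)) x = Torus.liftAt w (x + a)`,
`SmoothEulerCoerciveForce.Negative.liftAt_comp_add_right`). [folklore] -/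
theorem laplacian_comp_add_right (w : UnitAddTorus (Fin 3) → EuclideanSpace ℝ (Fin 3))
    (a x : UnitAddTorus (Fin 3)) :
    Torus.laplacian (fun y => w (y + a)) x = Torus.laplacian w (x + a) := by
  unfold Torus.laplacian
  rw [SmoothEulerCoerciveForce.Negative.liftAt_comp_add_right]

/-- **Translates of band tests are band tests** (the band space `V_N` is translation invariant:
`𝓕(g(· + a))(k) = e_k(a) • ĝ(k)`). [folklore] -/
theorem isBandTest_comp_add_right {g : UnitAddTorus (Fin 3) → EuclideanSpace ℝ (Fin 3)}
    (hg : IsBandTest N g) (a : UnitAddTorus (Fin 3)) : IsBandTest N (fun x => g (x + a)) := by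
  refine ⟨hg.1.comp_add_right a, SmoothEulerCoerciveForce.Negative.isDivFree_comp_add_right hg.2.1 a,
    SmoothEulerCoerciveForce.Negative.hasZeroMean_comp_add_right hg.2.2.1 a, fun k hk => ?_⟩
  have h : (EuclideanSpace.complexify ∘ fun x => g (x + a)) =
      fun x => (EuclideanSpace.complexify ∘ g) (x + a) := rfl
  rw [h, Torus.mFourierCoeff_comp_add_right, hg.2.2.2 k hk, smul_zero]

/-! ## Covariance of the generator pairing -/

/-- **Translation covariance of the generator pairing.** If the force satisfies `f (x + a) = f x`
and `u, u' ∈ H` are represented a.e. by `U` and `U(· - a)`, then for every test field `w`: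
`⟨F(u), w(· + a)⟩ = ⟨F(u'), w⟩` (all three terms of `nsGeneratorPairing` are integrals over `T³`,
invariant under the change of variables `x ↦ x + a`; derivatives commute with translations).
[folklore] -/
theorem nsGeneratorPairing_translate (ν : ℝ) {f : UnitAddTorus (Fin 3) → EuclideanSpace ℝ (Fin 3)}
    (a : UnitAddTorus (Fin 3)) (hfa : ∀ x, f (x + a) = f x)
    {u u' : Torus.energySpace (Fin 3)} {U : UnitAddTorus (Fin 3) → EuclideanSpace ℝ (Fin 3)}
    (hu : (u.1 : UnitAddTorus (Fin 3) → EuclideanSpace ℝ (Fin 3)) =ᵐ[volume] U)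
    (hu' : (u'.1 : UnitAddTorus (Fin 3) → EuclideanSpace ℝ (Fin 3)) =ᵐ[volume] fun y => U (y - a))
    (w : UnitAddTorus (Fin 3) → EuclideanSpace ℝ (Fin 3)) :
    Torus.nsGeneratorPairing ν f u (fun x => w (x + a)) = Torus.nsGeneratorPairing ν f u' w := by
  have h1 : ∫ x, ⟪f x, w (x + a)⟫_ℝ = ∫ x, ⟪f x, w x⟫_ℝ := by
    have e : (fun x => ⟪f x, w (x + a)⟫_ℝ) = fun x => (fun y => ⟪f y, w y⟫_ℝ) (x + a) := by
      funext x
      show ⟪f x, w (x + a)⟫_ℝ = ⟪f (x + a), w (x + a)⟫_ℝ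
      rw [hfa x]
    rw [e]
    exact integral_add_right_eq_self (fun y => ⟪f y, w y⟫_ℝ) a
  have h2 : ∫ x, ⟪(u.1 : UnitAddTorus (Fin 3) → EuclideanSpace ℝ (Fin 3)) x,
        Torus.laplacian (fun y => w (y + a)) x⟫_ℝ =
      ∫ x, ⟪(u'.1 : UnitAddTorus (Fin 3) → EuclideanSpace ℝ (Fin 3)) x, Torus.laplacian w x⟫_ℝ := by
    have e := integral_add_right_eq_self (μ := (volume : Measure (UnitAddTorus (Fin 3))))
      (fun y => ⟪U (y - a), Torus.laplacian w y⟫_ℝ) a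
    simp only [add_sub_cancel_right] at e
    calc ∫ x, ⟪(u.1 : UnitAddTorus (Fin 3) → EuclideanSpace ℝ (Fin 3)) x,
          Torus.laplacian (fun y => w (y + a)) x⟫_ℝ
        = ∫ x, ⟪U x, Torus.laplacian w (x + a)⟫_ℝ := by
          refine integral_congr_ae ?_
          filter_upwards [hu] with x hx
          rw [hx, laplacian_comp_add_right]
      _ = ∫ y, ⟪U (y - a), Torus.laplacian w y⟫_ℝ := e
      _ = ∫ x, ⟪(u'.1 : UnitAddTorus (Fin 3) → EuclideanSpace ℝ (Fin 3)) x, Torus.laplacian w x⟫_ℝ := by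
          refine integral_congr_ae ?_
          filter_upwards [hu'] with x hx
          rw [hx]
  have h3 : Torus.inertialPairing u.1 (fun x => w (x + a)) = Torus.inertialPairing u'.1 w := by
    unfold Torus.inertialPairing
    have e := integral_add_right_eq_self (μ := (volume : Measure (UnitAddTorus (Fin 3))))
      (fun y => ⟪Torus.fderiv w y (U (y - a)), U (y - a)⟫_ℝ) a
    simp only [add_sub_cancel_right] at e
    calc ∫ x, ⟪Torus.fderiv (fun y => w (y + a)) x
            ((u.1 : UnitAddTorus (Fin 3) → EuclideanSpace ℝ (Fin 3)) x),
          (u.1 : UnitAddTorus (Fin 3) → EuclideanSpace ℝ (Fin 3)) x⟫_ℝ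
        = ∫ x, ⟪Torus.fderiv w (x + a) (U x), U x⟫_ℝ := by
          refine integral_congr_ae ?_
          filter_upwards [hu] with x hx
          rw [hx, SmoothEulerCoerciveForce.Negative.fderiv_comp_add_right]
      _ = ∫ y, ⟪Torus.fderiv w y (U (y - a)), U (y - a)⟫_ℝ := e
      _ = ∫ x, ⟪Torus.fderiv w x ((u'.1 : UnitAddTorus (Fin 3) → EuclideanSpace ℝ (Fin 3)) x),
          (u'.1 : UnitAddTorus (Fin 3) → EuclideanSpace ℝ (Fin 3)) x⟫_ℝ := by
          refine integral_congr_ae ?_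
          filter_upwards [hu'] with x hx
          rw [hx]
  unfold Torus.nsGeneratorPairing
  rw [h1, h2, h3]

/-! ## Translates of level-`N` fields in coordinates -/

/-- The coordinates of a class represented a.e. by `Σ_l x_l b_l` are `x`. [folklore] -/
theorem coords_of_ae_eq_sum (hb : ∀ i, IsBandTest N (b i))
    (hbo : ∀ i j, ∫ x, ⟪b i x, b j x⟫_ℝ = if i = j then (1 : ℝ) else 0)
    {u : Torus.energySpace (Fin 3)} {x : Fin n → ℝ}
    (hu : (u.1 : UnitAddTorus (Fin 3) → EuclideanSpace ℝ (Fin 3)) =ᵐ[volume]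
      fun y => ∑ l, x l • b l y) (l : Fin n) :
    Torus.pairing u.1 (b l) = x l := by
  calc Torus.pairing u.1 (b l) = ∫ y, ⟪∑ j, x j • b j y, b l y⟫_ℝ := by
        refine integral_congr_ae ?_
        filter_upwards [hu] with y hy
        rw [hy]
    _ = x l := integral_inner_sum_smul_left hb hbo x l

/-- **The translate of a level-`N` field in coordinates.** For a level-`N` `u` with smooth
representative `U = Σ_j (u, b_j) b_j`: `U (y - a) = Σ_l (u, b_l(· + a)) b_l (y)` — the translate
`u(· - a)` has coordinate vector `((u, b_l(· + a)))_l`. [folklore] -/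
theorem synthesis_translate (hb : ∀ i, IsBandTest N (b i))
    (hbs : ∀ u : Torus.energySpace (Fin 3), IsLevel N u →
      ∀ x, Torus.fourierTruncate N (u.1 : UnitAddTorus (Fin 3) → EuclideanSpace ℝ (Fin 3)) x =
        ∑ i, Torus.pairing u.1 (b i) • b i x)
    (u : Torus.energySpace (Fin 3)) (hu : IsLevel N u) (a y : UnitAddTorus (Fin 3)) :
    (∑ j, Torus.pairing u.1 (b j) • b j (y - a)) =
      ∑ l, Torus.pairing u.1 (fun x => b l (x + a)) • b l y := by
  set x : Fin n → ℝ := fun j => Torus.pairing u.1 (b j) with hx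
  have hU : IsBandTest N (fun y => ∑ j, x j • b j y) := sum_smul_band Finset.univ x hb
  have hUa : IsBandTest N (fun y => ∑ j, x j • b j (y + -a)) := isBandTest_comp_add_right hU (-a)
  have h1 := band_eq_sum_smul hbs hUa y
  simp only [← sub_eq_add_neg] at h1
  rw [h1]
  refine Finset.sum_congr rfl fun l _ => ?_
  congr 1
  have e := integral_sub_right_eq_self (μ := (volume : Measure (UnitAddTorus (Fin 3))))
    (fun w => ⟪∑ j, x j • b j w, b l (w + a)⟫_ℝ) a
  simp only [sub_add_cancel] at e
  rw [e]
  refine integral_congr_ae ?_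
  filter_upwards [coe_ae_eq_sum_of_level hbs u hu] with w hw
  rw [hw]

/-- **Pairings of a translate with a translated test.** If `u` is level-`N` and `u'` is represented
a.e. by `Σ_l (u, b_l(· + a')) b_l` (i.e. `u' = u(· - a')`), then
`(u', g(· + a)) = (u, g(· + (a + a')))` for every field `g`. [folklore] -/
theorem pairing_translate_of_ae_eq (hb : ∀ i, IsBandTest N (b i))
    (hbs : ∀ u : Torus.energySpace (Fin 3), IsLevel N u →
      ∀ x, Torus.fourierTruncate N (u.1 : UnitAddTorus (Fin 3) → EuclideanSpace ℝ (Fin 3)) x =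
        ∑ i, Torus.pairing u.1 (b i) • b i x)
    {u u' : Torus.energySpace (Fin 3)} (hu : IsLevel N u) {a' : UnitAddTorus (Fin 3)}
    (hu' : (u'.1 : UnitAddTorus (Fin 3) → EuclideanSpace ℝ (Fin 3)) =ᵐ[volume]
      fun y => ∑ l, Torus.pairing u.1 (fun x => b l (x + a')) • b l y)
    (g : UnitAddTorus (Fin 3) → EuclideanSpace ℝ (Fin 3)) (a : UnitAddTorus (Fin 3)) :
    Torus.pairing u'.1 (fun x => g (x + a)) = Torus.pairing u.1 (fun x => g (x + (a + a'))) := by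
  have hrep : (u'.1 : UnitAddTorus (Fin 3) → EuclideanSpace ℝ (Fin 3)) =ᵐ[volume]
      fun y => ∑ j, Torus.pairing u.1 (b j) • b j (y - a') := by
    filter_upwards [hu'] with y hy
    rw [hy, synthesis_translate hb hbs u hu a' y]
  have e := integral_sub_right_eq_self (μ := (volume : Measure (UnitAddTorus (Fin 3))))
    (fun w => ⟪∑ j, Torus.pairing u.1 (b j) • b j w, g (w + (a + a'))⟫_ℝ) a'
  have e' : ∀ y : UnitAddTorus (Fin 3), y - a' + (a + a') = y + a := fun y => by abel
  simp only [e'] at e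
  calc Torus.pairing u'.1 (fun x => g (x + a))
      = ∫ y, ⟪∑ j, Torus.pairing u.1 (b j) • b j (y - a'), g (y + a)⟫_ℝ := by
        refine integral_congr_ae ?_
        filter_upwards [hrep] with y hy
        rw [hy]
    _ = ∫ w, ⟪∑ j, Torus.pairing u.1 (b j) • b j w, g (w + (a + a'))⟫_ℝ := e
    _ = Torus.pairing u.1 (fun x => g (x + (a + a'))) := by
        refine integral_congr_ae ?_
        filter_upwards [coe_ae_eq_sum_of_level hbs u hu] with w hw
        rw [hw]

/-- **The row of a translated test family.** For a force with `f (x + a) = f x`, a level-`N`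
field `u` and `u' = u(· - a)` (represented a.e. by `Σ_l (u, b_l(· + a)) b_l`), the row of the
translated family `(b(· + a), P)` at `u` is the row of `(b, P)` at `u'`:
`⟨F(u), ∇_{b(·+a)} p(u)⟩ = ⟨F(u'), ∇_b p(u')⟩`. [folklore] -/
theorem nsGeneratorPairing_polyGrad_translate (hb : ∀ i, IsBandTest N (b i))
    (hbo : ∀ i j, ∫ x, ⟪b i x, b j x⟫_ℝ = if i = j then (1 : ℝ) else 0)
    (hbs : ∀ u : Torus.energySpace (Fin 3), IsLevel N u →
      ∀ x, Torus.fourierTruncate N (u.1 : UnitAddTorus (Fin 3) → EuclideanSpace ℝ (Fin 3)) x =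
        ∑ i, Torus.pairing u.1 (b i) • b i x)
    (ν : ℝ) {f : UnitAddTorus (Fin 3) → EuclideanSpace ℝ (Fin 3)} (a : UnitAddTorus (Fin 3))
    (hfa : ∀ x, f (x + a) = f x) {u u' : Torus.energySpace (Fin 3)} (hu : IsLevel N u)
    (hu' : (u'.1 : UnitAddTorus (Fin 3) → EuclideanSpace ℝ (Fin 3)) =ᵐ[volume]
      fun y => ∑ l, Torus.pairing u.1 (fun x => b l (x + a)) • b l y)
    (P : MvPolynomial (Fin n) ℝ) :
    Torus.nsGeneratorPairing ν f u (polyGrad (fun l x => b l (x + a)) P u) =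
      Torus.nsGeneratorPairing ν f u' (polyGrad b P u') := by
  have hco : (fun l => Torus.pairing u'.1 (b l)) = fun l => Torus.pairing u.1 (fun x => b l (x + a)) :=
    funext fun l => coords_of_ae_eq_sum hb hbo hu' l
  have hfield : polyGrad (fun l x => b l (x + a)) P u = fun x => polyGrad b P u' (x + a) := by
    funext x
    unfold polyGrad
    rw [hco]
  have hrep : (u'.1 : UnitAddTorus (Fin 3) → EuclideanSpace ℝ (Fin 3)) =ᵐ[volume]
      fun y => (fun z => ∑ j, Torus.pairing u.1 (b j) • b j z) (y - a) := by
    filter_upwards [hu'] with y hy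
    rw [hy, synthesis_translate hb hbs u hu a y]
  rw [hfield]
  exact nsGeneratorPairing_translate ν a hfa (coe_ae_eq_sum_of_level hbs u hu) hrep _

/-! ## The translated family as a substituted polynomial -/

/-- **The differential field of the translated family** is that of `(b, P ∘ ρ(a))`,
`ρ(a)_{jl} = ∫⟪b_j(· + a), b_l⟫`. [folklore] -/
theorem polyGrad_bind₁_translate (hb : ∀ i, IsBandTest N (b i))
    (hbs : ∀ u : Torus.energySpace (Fin 3), IsLevel N u →
      ∀ x, Torus.fourierTruncate N (u.1 : UnitAddTorus (Fin 3) → EuclideanSpace ℝ (Fin 3)) x =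
        ∑ i, Torus.pairing u.1 (b i) • b i x)
    (a : UnitAddTorus (Fin 3)) (P : MvPolynomial (Fin n) ℝ) (u : Torus.energySpace (Fin 3))
    (x : UnitAddTorus (Fin 3)) :
    polyGrad b (bind₁ (fun j => ∑ l, C (∫ y, ⟪b j (y + a), b l y⟫_ℝ) *
      (X l : MvPolynomial (Fin n) ℝ)) P) u x = polyGrad (fun l x => b l (x + a)) P u x :=
  (polyGrad_transport (fun j l => ∫ y, ⟪b j (y + a), b l y⟫_ℝ)
    (fun j x => band_eq_sum_smul hbs (isBandTest_comp_add_right (hb j) a) x)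
    (fun u j => pairing_band_eq_sum hb hbs (isBandTest_comp_add_right (hb j) a) u) P u x).symm

/-- **The observable of the translated family** is that of `(b, P ∘ ρ(a))`. [folklore] -/
theorem eval_bind₁_translate (hb : ∀ i, IsBandTest N (b i))
    (hbs : ∀ u : Torus.energySpace (Fin 3), IsLevel N u →
      ∀ x, Torus.fourierTruncate N (u.1 : UnitAddTorus (Fin 3) → EuclideanSpace ℝ (Fin 3)) x =
        ∑ i, Torus.pairing u.1 (b i) • b i x)
    (a : UnitAddTorus (Fin 3)) (P : MvPolynomial (Fin n) ℝ) (u : Torus.energySpace (Fin 3)) :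
    eval (fun l => Torus.pairing u.1 (b l)) (bind₁ (fun j => ∑ l, C (∫ y, ⟪b j (y + a), b l y⟫_ℝ) *
      (X l : MvPolynomial (Fin n) ℝ)) P) = eval (fun j => Torus.pairing u.1 (fun x => b j (x + a))) P :=
  (eval_pairing_transport (fun j l => ∫ y, ⟪b j (y + a), b l y⟫_ℝ)
    (fun u j => pairing_band_eq_sum hb hbs (isBandTest_comp_add_right (hb j) a) u) P u).symm

/-- **The observable of `(b, P ∘ ρ(a))` through a second translate.** For a level-`N` `u` and
`u' = u(· - a')`: `(P ∘ ρ(a))((u, b(· + a'))) = P((u, b(· + (a + a'))))`. [folklore] -/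
theorem eval_translate_bind₁_translate (hb : ∀ i, IsBandTest N (b i))
    (hbo : ∀ i j, ∫ x, ⟪b i x, b j x⟫_ℝ = if i = j then (1 : ℝ) else 0)
    (hbs : ∀ u : Torus.energySpace (Fin 3), IsLevel N u →
      ∀ x, Torus.fourierTruncate N (u.1 : UnitAddTorus (Fin 3) → EuclideanSpace ℝ (Fin 3)) x =
        ∑ i, Torus.pairing u.1 (b i) • b i x)
    {u u' : Torus.energySpace (Fin 3)} (hu : IsLevel N u) {a' : UnitAddTorus (Fin 3)}
    (hu' : (u'.1 : UnitAddTorus (Fin 3) → EuclideanSpace ℝ (Fin 3)) =ᵐ[volume]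
      fun y => ∑ l, Torus.pairing u.1 (fun x => b l (x + a')) • b l y)
    (a : UnitAddTorus (Fin 3)) (P : MvPolynomial (Fin n) ℝ) :
    eval (fun l => Torus.pairing u.1 (fun x => b l (x + a')))
        (bind₁ (fun j => ∑ l, C (∫ y, ⟪b j (y + a), b l y⟫_ℝ) * (X l : MvPolynomial (Fin n) ℝ)) P) =
      eval (fun j => Torus.pairing u.1 (fun x => b j (x + (a + a')))) P := by
  have hco : (fun l => Torus.pairing u.1 (fun x => b l (x + a'))) = fun l => Torus.pairing u'.1 (b l) :=
    funext fun l => (coords_of_ae_eq_sum hb hbo hu' l).symm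
  have hco' : (fun j => Torus.pairing u'.1 (fun x => b j (x + a))) =
      fun j => Torus.pairing u.1 (fun x => b j (x + (a + a'))) :=
    funext fun j => pairing_translate_of_ae_eq hb hbs hu hu' (b j) a
  rw [hco, eval_bind₁_translate hb hbs a P u', hco']

/-! ## Invariant laws -/

/-- **Invariant cylindrical statistics integrate translated coordinate polynomials to the same
value**: if the law of `((u, b_i(· + a)))_i` under `μ` equals the law of `((u, b_i))_i`, then
`∫ Q((u, b(· + a))) dμ = ∫ Q((u, b)) dμ` for every polynomial `Q`. [folklore] -/
theorem integral_eval_translate_eq (hb : ∀ i, IsBandTest N (b i))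
    {μ : Measure (Torus.energySpace (Fin 3))} {a : UnitAddTorus (Fin 3)}
    (hsym : Measure.map (fun u : Torus.energySpace (Fin 3) => fun i =>
        Torus.pairing u.1 (fun x => b i (x + a))) μ =
      Measure.map (fun u : Torus.energySpace (Fin 3) => fun i => Torus.pairing u.1 (b i)) μ)
    (Q : MvPolynomial (Fin n) ℝ) :
    ∫ u, eval (fun i => Torus.pairing u.1 (fun x => b i (x + a))) Q ∂μ =
      ∫ u, eval (fun i => Torus.pairing u.1 (b i)) Q ∂μ := by
  have hφa : Continuous fun u : Torus.energySpace (Fin 3) => fun i =>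
      Torus.pairing u.1 (fun x => b i (x + a)) :=
    continuous_coords fun i => isBandTest_comp_add_right (hb i) a
  have hφ : Continuous fun u : Torus.energySpace (Fin 3) => fun i => Torus.pairing u.1 (b i) :=
    continuous_coords hb
  have hQ : Continuous fun x : Fin n → ℝ => eval x Q := continuous_eval Q
  rw [← integral_map hφa.measurable.aemeasurable hQ.aestronglyMeasurable, hsym,
    integral_map hφ.measurable.aemeasurable hQ.aestronglyMeasurable]

end AxialCert

/-- **Registered sub-goal `axialCert_rowTranslate` of stub S3′** (summary of this file): for an
orthonormal band basis `b` of `V_N`, a force with `f (x + a) = f x`, a level-`N` field `u` and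
`u' = u(· - a)` (represented a.e. by `Σ_l (u, b_l(· + a)) b_l`), the row of the translated family
`(b(· + a), P)` at `u` is the row of `(b, P)` at `u'`. [folklore] -/
theorem axialCert_rowTranslate : ∀ {N n : ℕ} {b : Fin n → UnitAddTorus (Fin 3) → EuclideanSpace ℝ (Fin 3)},
    (∀ i, IsBandTest N (b i)) → (∀ i j, ∫ x, ⟪b i x, b j x⟫_ℝ = if i = j then (1 : ℝ) else 0) →
    (∀ u : Torus.energySpace (Fin 3), IsLevel N u →
      ∀ x, Torus.fourierTruncate N (u.1 : UnitAddTorus (Fin 3) → EuclideanSpace ℝ (Fin 3)) x =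
        ∑ i, Torus.pairing u.1 (b i) • b i x) →
    ∀ (ν : ℝ) (f : UnitAddTorus (Fin 3) → EuclideanSpace ℝ (Fin 3)) (a : UnitAddTorus (Fin 3)),
    (∀ x, f (x + a) = f x) → ∀ (u u' : Torus.energySpace (Fin 3)), IsLevel N u →
    ((u'.1 : UnitAddTorus (Fin 3) → EuclideanSpace ℝ (Fin 3)) =ᵐ[volume]
      fun y => ∑ l, Torus.pairing u.1 (fun x => b l (x + a)) • b l y) →
    ∀ P : MvPolynomial (Fin n) ℝ,
      Torus.nsGeneratorPairing ν f u (polyGrad (fun l x => b l (x + a)) P u) =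
        Torus.nsGeneratorPairing ν f u' (polyGrad b P u') :=
  fun hb hbo hbs ν _ a hfa _ _ hu hu' P =>
    AxialCert.nsGeneratorPairing_polyGrad_translate hb hbo hbs ν a hfa hu hu' P

end Summit.AnomalousDissipation.AnomalousDissipation.Theorems.MomentParityQuarticGate
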